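import Summits.ResolutionOfSingularities.ResolutionOfSingularities.Theorems.PurelyInseparableDim4ResConeKTwoFiveLedger
import HarnessLib
import HarnessLib.Audit.Tags

/-!
# Purely inseparable four-folds — the SLICE-C SOCKET of the K2(5) end state: the two witnessed-TAIL binder blocks
# (B∞ at `(p,d) = (5,3)`, D∞ at `(5,4)`) that the slice-C programmes must refute (cell `res-dim4-pi`, K2(p) lane, holder file)

[OURS · counted 0 · cell `res-dim4-pi` · K2(p) lane holder res-dim4-p-12 g4.]  Nothing here proves K2(5)
(`RidgeBudget.NoAboveFloorTrap 5 5`), `NoIsolatedTrap 5 5` or resolution of singularities in dimension ≥ 4 /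
characteristic `p` — NOT proved.  AI kernel work, weaker than expert review.

res-dim4-p-3 g4's `noAboveFloorTrap_five_iff_sliceC_of_rotation (hslotT) (hN4)` (`…KTwoFiveLedger`, p700433): modulo the two
presentation residuals, K2(5) ⟺ no isolated above-floor `Step0 5` chain with `x^{r₀} ∣ F₀`, CONSTANT shade `d ∈ {3,4}` and
`e_G ≡ 2` from `k = 0`.  The two slice-C programmes of the cell prove their kills in the WITNESSED-TAIL shape instead — a
witnessed chain (`FreeTail.IsWitnessedChain 5 c j b`, charts `j k`, translations `b k`) all of whose states are isolated and
above the floor, whose shade and `e_G` are constant only from some `k₀` on (res-dim4-p-5 g4's `no_tiltFree_tail_four_five`,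
p696973, is literally of this shape plus its tilt letters; the Φ-line's B∞ assembly will be too).  This file is the SOCKET:
* `no_binaryCone_trap_of_tail` — for one shade `d`, the witnessed-tail kill implies the constant-shade conjunct
  (witnesses by `FreeTail.exists_witnesses`, `k₀ := 0`);
* `binaryCone_tail_of_noAboveFloorTrap_five` — conversely K2(5) kills every such tail outright (the chain itself is an
  above-floor isolated trap; no residual needed);
* **`noAboveFloorTrap_five_iff_no_binaryCone_tails (hslotT) (hN4)`** — THE END STATE IN SOCKET FORM: K2(5) ⟺ over every
  field of characteristic `5`, (TAIL-B) no witnessed all-isolated above-floor chain with `x^{r₀} ∣ F₀` has shade `≡ 3` and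
  `e_G ≡ 2` from some `k₀` on, and (TAIL-D) none has shade `≡ 4` and `e_G ≡ 2` from some `k₀` on — modulo `hslotT` (K24a-R1′)
  and `hN4` (K24b-R1), binders verbatim as in p-3 g4's p698919 / p700433;
* `noAboveFloorTrap_five_of_no_binaryCone_tails` — the `←` direction alone, the form the final assembly will call.
Slice C is OPEN at both `(5,3)` and `(5,4)`; nothing here proves K2(5).

[cite: CossartJannsenSaito2020, Thm. 3.14] bears_on: LADDER-RESOLUTION:D157-DOOR2 (res-dim4-pi · K2(p) · slice-C socket).
Supports stmt-ResolutionOfSingularities-16155 (helper).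
-/

set_option linter.dupNamespace false -- mandated namespace of this single-conjunct summit

noncomputable section

namespace Summit.ResolutionOfSingularities.ResolutionOfSingularities.Theorems.PIDim4

namespace ResCone

open MvPolynomial
open Literature.AlgebraicGeometry.Resolution
open Literature.AlgebraicGeometry.Resolution.CentreBlowup
open Literature.AlgebraicGeometry.Resolution.Hauser2010
open Literature.AlgebraicGeometry.Resolution.HauserPerlega2019
open RidgeBudget (NoAboveFloorTrap)

/-- **One shade, tail ⇒ trap.**  If over `K` no witnessed all-isolated above-floor `Step0 5` chain with `x^{r₀} ∣ F₀` has
shade `≡ d` and `e_G ≡ 2` from some index on, then there is no isolated above-floor `Step0 5` chain with `x^{r₀} ∣ F₀` of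
constant shade `d` and `e_G ≡ 2` (witnesses from `FreeTail.exists_witnesses`, `k₀ := 0`). [OURS · bookkeeping]
[cite: CossartJannsenSaito2020, Thm. 3.14] -/
theorem no_binaryCone_trap_of_tail {K : Type} [Field K] [CharP K 5] [DecidableEq K] {d : ℕ}
    (htail : ∀ (c : ℕ → State K) (j : ℕ → Fin 4) (b : ℕ → Fin 4 → K),
      (∀ k, IsIsolated 5 (c k).F ∧ Step0 5 (c k) (c (k + 1))) → FreeTail.IsWitnessedChain 5 c j b →
      (∀ e ∈ (c 0).F.support, (c 0).r ≤ e) → (∀ k, ordZero (c k).F ≠ (5 : ℕ)) →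
      ∀ k₀ : ℕ, (∀ k, k₀ ≤ k → (c k).shade = (d : ℕ∞)) →
      (∀ k, k₀ ≤ k → Module.finrank K (resVertex (c k)) = 2) → False) :
    ¬ ∃ c : ℕ → State K, (∀ e' ∈ (c 0).F.support, (c 0).r ≤ e') ∧
      ∀ k, IsIsolated 5 (c k).F ∧ Step0 5 (c k) (c (k + 1)) ∧ ordZero (c k).F ≠ (5 : ℕ) ∧
        (c k).shade = (d : ℕ∞) ∧ Module.finrank K (resVertex (c k)) = 2 := by
  rintro ⟨c, hr0, hc⟩
  obtain ⟨j, b, hw⟩ := FreeTail.exists_witnesses (q := 5) (c := c) fun k => (hc k).2.1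
  exact htail c j b (fun k => ⟨(hc k).1, (hc k).2.1⟩) hw hr0 (fun k => (hc k).2.2.1) 0
    (fun k _ => (hc k).2.2.2.1) (fun k _ => (hc k).2.2.2.2)

/-- **Trap-freeness kills every tail, outright.**  If `NoAboveFloorTrap 5 5` holds, then over `K` every witnessed all-isolated
above-floor `Step0 5` chain is contradictory — whatever its shade / `e_G` data (the chain itself is an above-floor isolated
trap).  Stated in the TAIL-`d` binder shape for direct use. [OURS · bookkeeping] [cite: CossartJannsenSaito2020, Thm. 3.14] -/
theorem binaryCone_tail_of_noAboveFloorTrap_five (h : NoAboveFloorTrap 5 5) (K : Type) [Field K] [CharP K 5]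
    [DecidableEq K] (d : ℕ) (c : ℕ → State K) (j : ℕ → Fin 4) (b : ℕ → Fin 4 → K)
    (hc : ∀ k, IsIsolated 5 (c k).F ∧ Step0 5 (c k) (c (k + 1))) (_hw : FreeTail.IsWitnessedChain 5 c j b)
    (_hr0 : ∀ e ∈ (c 0).F.support, (c 0).r ≤ e) (hfloor : ∀ k, ordZero (c k).F ≠ (5 : ℕ)) (k₀ : ℕ)
    (_hshade : ∀ k, k₀ ≤ k → (c k).shade = (d : ℕ∞))
    (_he : ∀ k, k₀ ≤ k → Module.finrank K (resVertex (c k)) = 2) : False :=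
  h K ⟨c, fun k => ⟨(hc k).1, (hc k).2, hfloor k⟩⟩

/-- **SLICE C IN SOCKET FORM ⇒ K2(5), modulo the two presentation residuals.**  Given `hslotT` (K24a-R1′) and `hN4`
(K24b-R1) verbatim as in `noAboveFloorTrap_five_iff_sliceC_of_rotation`, the two witnessed-tail kills (TAIL-B at shade `3`,
TAIL-D at shade `4`; all states isolated and above the floor, `x^{r₀} ∣ F₀`, shade and `e_G = 2` constant from some `k₀` on)
over every field of characteristic `5` imply `NoAboveFloorTrap 5 5`. [OURS · conditional on the named residuals]
[cite: CossartJannsenSaito2020, Thm. 3.14] -/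
theorem noAboveFloorTrap_five_of_no_binaryCone_tails
    (hslotT : ∀ (K : Type) [Field K] [CharP K 5] [DecidableEq K] (c : ℕ → State K) (j : ℕ → Fin 4)
      (b : ℕ → Fin 4 → K), (∀ k, IsIsolated 5 (c k).F ∧ Step0 5 (c k) (c (k + 1))) →
      FreeTail.IsWitnessedChain 5 c j b → (∀ e ∈ (c 0).F.support, (c 0).r ≤ e) →
      (∀ k, ordZero (c k).F ≠ (5 : ℕ)) → ∀ k₀ : ℕ, (∀ k, k₀ ≤ k → (c k).shade = ((3 : ℕ) : ℕ∞)) →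
      (∀ k, k₀ ≤ k → Module.finrank K (resVertex (c k)) = 3) →
      ∀ (ν : Fin 4) (k₁ : ℕ), k₀ ≤ k₁ → (∀ k, k₁ ≤ k → 1 ≤ (c k).r ν ∧ j k ≠ ν ∧ b k ν = 0) →
      (∀ k, k₁ ≤ k → ∀ i, i ≠ ν → 1 ≤ (c k).r i →
        ∃ t, k₀ ≤ t ∧ t < k ∧ j t = i ∧ ∀ m, t < m → m < k → j m ≠ i ∧ b m i = 0) →
      (∀ ℓ : Fin 4 → K, (∀ w, w ∈ resVertex (c k₁) ↔ dotProduct ℓ w = 0) →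
        ∀ i, (c k₁).r i = 0 → ℓ i ≠ 0) → ∀ k, k₁ ≤ k → 1 ≤ (c k).r (j k))
    (hN4 : ∀ (K : Type) [Field K] [CharP K 5] [DecidableEq K] (c : ℕ → State K) (j : ℕ → Fin 4)
      (b : ℕ → Fin 4 → K), (∀ k, IsIsolated 5 (c k).F ∧ Step0 5 (c k) (c (k + 1))) →
      FreeTail.IsWitnessedChain 5 c j b → (∀ e ∈ (c 0).F.support, (c 0).r ≤ e) →
      (∀ k, ordZero (c k).F ≠ (5 : ℕ)) → ∀ k₀ : ℕ, (∀ k, k₀ ≤ k → (c k).shade = ((4 : ℕ) : ℕ∞)) →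
      (∀ k, k₀ ≤ k → Module.finrank K (resVertex (c k)) = 3) →
      ∀ k₁ : ℕ, k₀ ≤ k₁ → (∀ k, k₀ ≤ k → (∀ i, (c k).r i ≤ 1) ∧ (c k).r.degree = 2) →
      (∀ k, k₁ ≤ k → ∀ i, 1 ≤ (c k).r i →
        ∃ t, k₀ ≤ t ∧ t < k ∧ j t = i ∧ ∀ m, t < m → m < k → j m ≠ i ∧ b m i = 0) →
      ∃ (c' : ℕ → State K) (j' : ℕ → Fin 4) (b' : ℕ → Fin 4 → K) (k₀' k₁' : ℕ),
        (∀ k, IsIsolated 5 (c' k).F ∧ Step0 5 (c' k) (c' (k + 1))) ∧ FreeTail.IsWitnessedChain 5 c' j' b' ∧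
        (∀ e ∈ (c' 0).F.support, (c' 0).r ≤ e) ∧ (∀ k, ordZero (c' k).F ≠ (5 : ℕ)) ∧
        (∀ k, k₀' ≤ k → (c' k).shade = ((4 : ℕ) : ℕ∞)) ∧
        (∀ k, k₀' ≤ k → Module.finrank K (resVertex (c' k)) = 3) ∧ k₀' ≤ k₁' ∧
        (∀ k, k₀' ≤ k → (∀ i, (c' k).r i ≤ 1) ∧ (c' k).r.degree = 2) ∧
        (∀ k, k₁' ≤ k → ∀ i, 1 ≤ (c' k).r i →
          ∃ t, k₀' ≤ t ∧ t < k ∧ j' t = i ∧ ∀ m, t < m → m < k → j' m ≠ i ∧ b' m i = 0) ∧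
        (∀ k, k₁' ≤ k → 1 ≤ (c' k).r (j' k)))
    (hB : ∀ (K : Type) [Field K] [CharP K 5] [DecidableEq K] (c : ℕ → State K) (j : ℕ → Fin 4)
      (b : ℕ → Fin 4 → K), (∀ k, IsIsolated 5 (c k).F ∧ Step0 5 (c k) (c (k + 1))) →
      FreeTail.IsWitnessedChain 5 c j b → (∀ e ∈ (c 0).F.support, (c 0).r ≤ e) →
      (∀ k, ordZero (c k).F ≠ (5 : ℕ)) → ∀ k₀ : ℕ, (∀ k, k₀ ≤ k → (c k).shade = ((3 : ℕ) : ℕ∞)) →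
      (∀ k, k₀ ≤ k → Module.finrank K (resVertex (c k)) = 2) → False)
    (hD : ∀ (K : Type) [Field K] [CharP K 5] [DecidableEq K] (c : ℕ → State K) (j : ℕ → Fin 4)
      (b : ℕ → Fin 4 → K), (∀ k, IsIsolated 5 (c k).F ∧ Step0 5 (c k) (c (k + 1))) →
      FreeTail.IsWitnessedChain 5 c j b → (∀ e ∈ (c 0).F.support, (c 0).r ≤ e) →
      (∀ k, ordZero (c k).F ≠ (5 : ℕ)) → ∀ k₀ : ℕ, (∀ k, k₀ ≤ k → (c k).shade = ((4 : ℕ) : ℕ∞)) →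
      (∀ k, k₀ ≤ k → Module.finrank K (resVertex (c k)) = 2) → False) :
    NoAboveFloorTrap 5 5 := by
  refine (noAboveFloorTrap_five_iff_sliceC_of_rotation hslotT hN4).mpr fun K _ _ _ => ?_
  rintro ⟨c, d, h3, h4, hr0, hc⟩
  rcases Nat.lt_or_ge d 4 with hlt | hge
  · have hd : d = 3 := by omega
    subst hd
    exact no_binaryCone_trap_of_tail (hB K) ⟨c, hr0, fun k =>
      ⟨(hc k).1, (hc k).2.1, (hc k).2.2.1, by exact_mod_cast (hc k).2.2.2.1, (hc k).2.2.2.2⟩⟩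
  · have hd : d = 4 := by omega
    subst hd
    exact no_binaryCone_trap_of_tail (hD K) ⟨c, hr0, fun k =>
      ⟨(hc k).1, (hc k).2.1, (hc k).2.2.1, by exact_mod_cast (hc k).2.2.2.1, (hc k).2.2.2.2⟩⟩

/-- **THE K2(5) END STATE IN SOCKET FORM (holder's sentence of record).**  Given `hslotT` (K24a-R1′, res-dim4-p-1 g4) and `hN4`
(K24b-R1, res-dim4-typ-1 g3) verbatim as in res-dim4-p-3 g4's `noAboveFloorTrap_five_iff_sliceC_of_rotation` (p700433):
`RidgeBudget.NoAboveFloorTrap 5 5` holds **iff** over every field of characteristic `5`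
(TAIL-B) no witnessed all-isolated above-floor `Step0 5` chain with `x^{r₀} ∣ F₀` has shade `≡ 3` and `e_G ≡ 2` from some `k₀`
on (the B∞ socket, `(p,d) = (5,3)`: the Φ-line of res-dim4-idea-1 / res-dim4-p-11), and
(TAIL-D) none has shade `≡ 4` and `e_G ≡ 2` from some `k₀` on (the D∞ socket, `(5,4)`: res-dim4-p-5's programme, tilt-free
case p696281/p696973 ✓).  Slice C is OPEN at both sockets; nothing here proves K2(5). [OURS · conditional on the named
residuals] [cite: CossartJannsenSaito2020, Thm. 3.14] -/
theorem noAboveFloorTrap_five_iff_no_binaryCone_tails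
    (hslotT : ∀ (K : Type) [Field K] [CharP K 5] [DecidableEq K] (c : ℕ → State K) (j : ℕ → Fin 4)
      (b : ℕ → Fin 4 → K), (∀ k, IsIsolated 5 (c k).F ∧ Step0 5 (c k) (c (k + 1))) →
      FreeTail.IsWitnessedChain 5 c j b → (∀ e ∈ (c 0).F.support, (c 0).r ≤ e) →
      (∀ k, ordZero (c k).F ≠ (5 : ℕ)) → ∀ k₀ : ℕ, (∀ k, k₀ ≤ k → (c k).shade = ((3 : ℕ) : ℕ∞)) →
      (∀ k, k₀ ≤ k → Module.finrank K (resVertex (c k)) = 3) →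
      ∀ (ν : Fin 4) (k₁ : ℕ), k₀ ≤ k₁ → (∀ k, k₁ ≤ k → 1 ≤ (c k).r ν ∧ j k ≠ ν ∧ b k ν = 0) →
      (∀ k, k₁ ≤ k → ∀ i, i ≠ ν → 1 ≤ (c k).r i →
        ∃ t, k₀ ≤ t ∧ t < k ∧ j t = i ∧ ∀ m, t < m → m < k → j m ≠ i ∧ b m i = 0) →
      (∀ ℓ : Fin 4 → K, (∀ w, w ∈ resVertex (c k₁) ↔ dotProduct ℓ w = 0) →
        ∀ i, (c k₁).r i = 0 → ℓ i ≠ 0) → ∀ k, k₁ ≤ k → 1 ≤ (c k).r (j k))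
    (hN4 : ∀ (K : Type) [Field K] [CharP K 5] [DecidableEq K] (c : ℕ → State K) (j : ℕ → Fin 4)
      (b : ℕ → Fin 4 → K), (∀ k, IsIsolated 5 (c k).F ∧ Step0 5 (c k) (c (k + 1))) →
      FreeTail.IsWitnessedChain 5 c j b → (∀ e ∈ (c 0).F.support, (c 0).r ≤ e) →
      (∀ k, ordZero (c k).F ≠ (5 : ℕ)) → ∀ k₀ : ℕ, (∀ k, k₀ ≤ k → (c k).shade = ((4 : ℕ) : ℕ∞)) →
      (∀ k, k₀ ≤ k → Module.finrank K (resVertex (c k)) = 3) →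
      ∀ k₁ : ℕ, k₀ ≤ k₁ → (∀ k, k₀ ≤ k → (∀ i, (c k).r i ≤ 1) ∧ (c k).r.degree = 2) →
      (∀ k, k₁ ≤ k → ∀ i, 1 ≤ (c k).r i →
        ∃ t, k₀ ≤ t ∧ t < k ∧ j t = i ∧ ∀ m, t < m → m < k → j m ≠ i ∧ b m i = 0) →
      ∃ (c' : ℕ → State K) (j' : ℕ → Fin 4) (b' : ℕ → Fin 4 → K) (k₀' k₁' : ℕ),
        (∀ k, IsIsolated 5 (c' k).F ∧ Step0 5 (c' k) (c' (k + 1))) ∧ FreeTail.IsWitnessedChain 5 c' j' b' ∧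
        (∀ e ∈ (c' 0).F.support, (c' 0).r ≤ e) ∧ (∀ k, ordZero (c' k).F ≠ (5 : ℕ)) ∧
        (∀ k, k₀' ≤ k → (c' k).shade = ((4 : ℕ) : ℕ∞)) ∧
        (∀ k, k₀' ≤ k → Module.finrank K (resVertex (c' k)) = 3) ∧ k₀' ≤ k₁' ∧
        (∀ k, k₀' ≤ k → (∀ i, (c' k).r i ≤ 1) ∧ (c' k).r.degree = 2) ∧
        (∀ k, k₁' ≤ k → ∀ i, 1 ≤ (c' k).r i →
          ∃ t, k₀' ≤ t ∧ t < k ∧ j' t = i ∧ ∀ m, t < m → m < k → j' m ≠ i ∧ b' m i = 0) ∧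
        (∀ k, k₁' ≤ k → 1 ≤ (c' k).r (j' k))) :
    NoAboveFloorTrap 5 5 ↔ ∀ (K : Type) [Field K] [CharP K 5] [DecidableEq K],
      (∀ (c : ℕ → State K) (j : ℕ → Fin 4) (b : ℕ → Fin 4 → K),
        (∀ k, IsIsolated 5 (c k).F ∧ Step0 5 (c k) (c (k + 1))) → FreeTail.IsWitnessedChain 5 c j b →
        (∀ e ∈ (c 0).F.support, (c 0).r ≤ e) → (∀ k, ordZero (c k).F ≠ (5 : ℕ)) →
        ∀ k₀ : ℕ, (∀ k, k₀ ≤ k → (c k).shade = ((3 : ℕ) : ℕ∞)) →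
        (∀ k, k₀ ≤ k → Module.finrank K (resVertex (c k)) = 2) → False) ∧
      (∀ (c : ℕ → State K) (j : ℕ → Fin 4) (b : ℕ → Fin 4 → K),
        (∀ k, IsIsolated 5 (c k).F ∧ Step0 5 (c k) (c (k + 1))) → FreeTail.IsWitnessedChain 5 c j b →
        (∀ e ∈ (c 0).F.support, (c 0).r ≤ e) → (∀ k, ordZero (c k).F ≠ (5 : ℕ)) →
        ∀ k₀ : ℕ, (∀ k, k₀ ≤ k → (c k).shade = ((4 : ℕ) : ℕ∞)) →
        (∀ k, k₀ ≤ k → Module.finrank K (resVertex (c k)) = 2) → False) :=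
  ⟨fun h K _ _ _ =>
    ⟨fun c j b hc hw hr0 hfloor k₀ hshade he =>
        binaryCone_tail_of_noAboveFloorTrap_five h K 3 c j b hc hw hr0 hfloor k₀ hshade he,
      fun c j b hc hw hr0 hfloor k₀ hshade he =>
        binaryCone_tail_of_noAboveFloorTrap_five h K 4 c j b hc hw hr0 hfloor k₀ hshade he⟩,
    fun h => noAboveFloorTrap_five_of_no_binaryCone_tails hslotT hN4 (fun K _ _ _ => (h K).1)
      fun K _ _ _ => (h K).2⟩

end ResCone

end Summit.ResolutionOfSingularities.ResolutionOfSingularities.Theorems.PIDim4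

end
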